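import Mathlib
import HarnessLib
import Literature.NumberTheory.GaloisRepresentations.EnormousSubgroup
import Literature.NumberTheory.GaloisRepresentations.ProjectiveTypeSolvable
import Literature.NumberTheory.GaloisRepresentations.SerreProp16PGL2
import Literature.NumberTheory.GaloisRepresentations.ResiduallyReducibleOfStableLine
import Summits.Langlands.Langlands.Theorems.NonParallelVoidTensorSquareParallelStubEnormousResidualPackageEnormousOfDihedral

/-!
# Stub `stub_qianPackage_of_primeToP` of line `potaut` for crux `LocallyReducibleParallel`
# (stmt-Langlands-17002) — helper 1a: `2 × 2` bookkeeping in `ad⁰` for the enormousness of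
# prime-to-`p` absolutely irreducible subgroups of `GL₂(k)`

Crux `stmt-Langlands-17002` = `Summit.Langlands.Langlands.Theses.NonParallelVoid.LocallyReducibleParallel`
(line `potaut`, stub `stub_qianPackage_of_primeToP`: Qian's residual package, hypotheses
(iii)–(iv) of Qian 2023 Thm. 1.4, for `ρ̄|_{Γ_{F(ζ_p)}}` absolutely irreducible with projective
image of order prime to `p`).  The companion file `…StubQianPackageOfPrimeToPEnormous` proves that
an absolutely irreducible `r : G → GL₂(k)` (`k` algebraically closed, `char k = p ≠ 2`) with finite
image of order prime to `p` has ENORMOUS image (ACC+ Def. 6.2.28) — uniformly for the dihedral and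
the primitive (`𝔄₄`, `𝔖₄`, `𝔄₅`) projective types.  This file holds the elementary matrix lemmas
of that proof, all about the adjoint action `Ad(g) M = g M g⁻¹` of `GL₂(k)` on the trace-zero
matrices `ad⁰` (tree `adZero`) and the matrix units `E₀₁`, `E₁₀ ∈ ad⁰`:

* `E01_mem_adZero`, `E10_mem_adZero`, `exists_E01_E10` (the matrix units as elements `E`, `F` of
  `ad⁰`, used below through hypotheses `hE`, `hF` pinning their matrices — no new definition),
  `eq_add_of_apply_zero_zero` (a trace-zero matrix with zero `(0,0)` entry is
  `w₀₁ E₀₁ + w₁₀ E₁₀`), `coe_smul_E01_add_smul_E10`, `coe_adGL_mul`;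
* `apply_one_zero_eq_zero_of_adGL_E01` / `apply_zero_one_eq_zero_of_adGL_E10` — if `Ad(g)` fixes
  the line `k E₀₁` (resp. `k E₁₀`) then `g` is upper (resp. lower) triangular;
  `isDg_or_isAd_of_adGL` — if `Ad(g) E₀₁` and `Ad(g) E₁₀` have zero diagonal then `g` is diagonal
  or antidiagonal; `adGL_E01_of_isDg`, `adGL_E10_of_isDg` — `Ad(diag(a,b))` has eigenvalues `a/b`,
  `b/a` on `E₀₁`, `E₁₀`; `det_coe_adGL`, `eq_one_or_eq_neg_one_of_adGL_eq_smul` — `Ad(g) w = c w`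
  with `det w ≠ 0` forces `c = ±1`;
* `hasCommonEigenvector_of_forall_apply_zero_one` — lower triangular groups have a common
  eigenvector (upper: tree `hasCommonEigenvector_of_apply_one_zero_eq_zero`);
  `exists_eq_smul_of_line` — a subspace of zero-diagonal matrices through
  `a E₀₁ + b E₁₀`, `a ≠ 0`, not containing both `E₀₁` and `E₁₀`, is a line;
* `isRegularSemisimple_of_not_mem_center`, `isRegularSemisimple_of_mem_of_not_mem_center` — a
  non-central element of `GL₂(k)` of finite order prime to `char k` (`k` algebraically closed) is
  regular semisimple (tree `Serre1972.exists_conj_eq_diagonal_of_natCast_ne_zero`);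
* `invariants_eq_bot_of_normalForm` — clause (2a) of "enormous" in the normal form of the companion
  file: if `r(G)` has no common eigenvector and contains `diag(a, b)`, `a ≠ b`, then
  `(ad⁰)^{r(G)} = 0` (`2 ≠ 0` in `k`).

## References

* [ACCGHLNSTT2023] P. B. Allen et al., *Potential automorphy over CM fields*, Ann. of Math. 197
  (2023) = arXiv:1812.09999, Def. 6.2.28.
* [Serre1972] J.-P. Serre, *Propriétés galoisiennes des points d'ordre fini des courbes
  elliptiques*, Invent. Math. 15 (1972), §2.5 (diagonalisation of prime-to-`p` elements).
-/

set_option linter.dupNamespace false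

noncomputable section

namespace Summit.Langlands.Langlands.Cruxes.LocallyReducibleParallel.Potaut

open scoped MatrixGroups Polynomial
open Matrix Literature.NumberTheory.GaloisRepresentations
open Summit.Langlands.Langlands.Cruxes.AdjointLiftingGL3.Birth
open Summit.Langlands.Langlands.Theorems.TensorSquareParallel

universe u v

/-! ## §1. `2 × 2` bookkeeping in `ad⁰` -/
section Matrices

variable {k : Type u} [Field k]

/-- The matrix unit `E₀₁` has trace zero. [folklore] -/
theorem E01_mem_adZero :
    (!![0, 1; 0, 0] : Matrix (Fin 2) (Fin 2) k) ∈ (adZero (Fin 2) k).toSubmodule := by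
  rw [mem_adZero_toSubmodule_iff, Matrix.trace_fin_two]; simp

/-- The matrix unit `E₁₀` has trace zero. [folklore] -/
theorem E10_mem_adZero :
    (!![0, 0; 1, 0] : Matrix (Fin 2) (Fin 2) k) ∈ (adZero (Fin 2) k).toSubmodule := by
  rw [mem_adZero_toSubmodule_iff, Matrix.trace_fin_two]; simp

/-- The matrix units `E₀₁`, `E₁₀` as elements of `ad⁰` (below always named `E`, `F`, with the
hypotheses `hE`, `hF` pinning their matrices). [folklore] -/
theorem exists_E01_E10 : ∃ E F : (adZero (Fin 2) k).toSubmodule,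
    (E : Matrix (Fin 2) (Fin 2) k) = !![0, 1; 0, 0] ∧
      (F : Matrix (Fin 2) (Fin 2) k) = !![0, 0; 1, 0] :=
  ⟨⟨_, E01_mem_adZero⟩, ⟨_, E10_mem_adZero⟩, rfl, rfl⟩

variable {E F : (adZero (Fin 2) k).toSubmodule}

/-- A trace-zero `2 × 2` matrix with zero `(0,0)` entry is `w₀₁ E₀₁ + w₁₀ E₁₀`. [folklore] -/
theorem eq_add_of_apply_zero_zero (hE : (E : Matrix (Fin 2) (Fin 2) k) = !![0, 1; 0, 0])
    (hF : (F : Matrix (Fin 2) (Fin 2) k) = !![0, 0; 1, 0]) (w : (adZero (Fin 2) k).toSubmodule)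
    (h00 : (w : Matrix (Fin 2) (Fin 2) k) 0 0 = 0) :
    w = (w : Matrix (Fin 2) (Fin 2) k) 0 1 • E + (w : Matrix (Fin 2) (Fin 2) k) 1 0 • F := by
  have htr : (w : Matrix (Fin 2) (Fin 2) k) 0 0 + (w : Matrix (Fin 2) (Fin 2) k) 1 1 = 0 := by
    rw [← Matrix.trace_fin_two]; exact w.2
  have h11 : (w : Matrix (Fin 2) (Fin 2) k) 1 1 = 0 := by rwa [h00, zero_add] at htr
  refine Subtype.ext ?_
  rw [Submodule.coe_add, Submodule.coe_smul, Submodule.coe_smul, hE, hF]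
  ext i j
  fin_cases i <;> fin_cases j <;> simp [h00, h11]

/-- The matrix of `a E₀₁ + b E₁₀`. [folklore] -/
theorem coe_smul_E01_add_smul_E10 (hE : (E : Matrix (Fin 2) (Fin 2) k) = !![0, 1; 0, 0])
    (hF : (F : Matrix (Fin 2) (Fin 2) k) = !![0, 0; 1, 0]) (a b : k) :
    ((a • E + b • F : (adZero (Fin 2) k).toSubmodule) : Matrix (Fin 2) (Fin 2) k) =
      !![0, a; b, 0] := by
  rw [Submodule.coe_add, Submodule.coe_smul, Submodule.coe_smul, hE, hF]
  ext i j
  fin_cases i <;> fin_cases j <;> simp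

/-- `Ad(g) M · g = g · M` (underlying matrices). [folklore] -/
theorem coe_adGL_mul (g : GL (Fin 2) k) (M : (adZero (Fin 2) k).toSubmodule) :
    (((adZero (Fin 2) k).toRepresentation g M : (adZero (Fin 2) k).toSubmodule) :
        Matrix (Fin 2) (Fin 2) k) * (g : Matrix (Fin 2) (Fin 2) k) =
      (g : Matrix (Fin 2) (Fin 2) k) * (M : Matrix (Fin 2) (Fin 2) k) := by
  rw [coe_adGL_apply, Matrix.mul_assoc, Units.inv_mul, Matrix.mul_one]

/-- If `Ad(g) E₀₁` is a multiple of `E₀₁` then `g` is upper triangular. [folklore] -/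
theorem apply_one_zero_eq_zero_of_adGL_E01 (hE : (E : Matrix (Fin 2) (Fin 2) k) = !![0, 1; 0, 0])
    {g : GL (Fin 2) k} {x : k} (h : (adZero (Fin 2) k).toRepresentation g E = x • E) :
    (g : Matrix (Fin 2) (Fin 2) k) 1 0 = 0 := by
  have h1 := coe_adGL_mul g E
  rw [h, Submodule.coe_smul, hE] at h1
  have e11 := congrFun (congrFun h1 1) 1
  simpa [Matrix.mul_apply, Fin.sum_univ_two] using e11.symm

/-- If `Ad(g) E₁₀` is a multiple of `E₁₀` then `g` is lower triangular. [folklore] -/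
theorem apply_zero_one_eq_zero_of_adGL_E10 (hF : (F : Matrix (Fin 2) (Fin 2) k) = !![0, 0; 1, 0])
    {g : GL (Fin 2) k} {x : k} (h : (adZero (Fin 2) k).toRepresentation g F = x • F) :
    (g : Matrix (Fin 2) (Fin 2) k) 0 1 = 0 := by
  have h1 := coe_adGL_mul g F
  rw [h, Submodule.coe_smul, hF] at h1
  have e00 := congrFun (congrFun h1 0) 0
  simpa [Matrix.mul_apply, Fin.sum_univ_two] using e00.symm

/-- If `Ad(g) E₀₁` and `Ad(g) E₁₀` both have zero diagonal then `g` is diagonal or antidiagonal.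
[folklore] -/
theorem isDg_or_isAd_of_adGL (hE : (E : Matrix (Fin 2) (Fin 2) k) = !![0, 1; 0, 0])
    (hF : (F : Matrix (Fin 2) (Fin 2) k) = !![0, 0; 1, 0]) (g : GL (Fin 2) k)
    (h1 : (((adZero (Fin 2) k).toRepresentation g E : (adZero (Fin 2) k).toSubmodule) :
      Matrix (Fin 2) (Fin 2) k) 0 0 = 0)
    (h2 : (((adZero (Fin 2) k).toRepresentation g F : (adZero (Fin 2) k).toSubmodule) :
      Matrix (Fin 2) (Fin 2) k) 0 0 = 0) :
    GL2.IsDg (g : Matrix (Fin 2) (Fin 2) k) ∨ GL2.IsAd (g : Matrix (Fin 2) (Fin 2) k) := by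
  set w₁ : (adZero (Fin 2) k).toSubmodule := (adZero (Fin 2) k).toRepresentation g E with hw₁
  set w₂ : (adZero (Fin 2) k).toSubmodule := (adZero (Fin 2) k).toRepresentation g F with hw₂
  have e₁ := coe_adGL_mul g E
  have e₂ := coe_adGL_mul g F
  rw [← hw₁, hE] at e₁
  rw [← hw₂, hF] at e₂
  -- entrywise: `x g₁₀ = 0`, `x g₁₁ = g₀₀` (`x = (w₁)₀₁`); `x' g₁₀ = g₀₁`, `x' g₁₁ = 0` (`x' = (w₂)₀₁`)
  have a00 := congrFun (congrFun e₁ 0) 0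
  have a01 := congrFun (congrFun e₁ 0) 1
  have b00 := congrFun (congrFun e₂ 0) 0
  have b01 := congrFun (congrFun e₂ 0) 1
  simp only [Matrix.mul_apply, Fin.sum_univ_two, h1, h2, zero_mul, zero_add, Matrix.of_apply,
    Matrix.cons_val', Matrix.cons_val_zero, Matrix.cons_val_one, Matrix.cons_val_fin_one,
    mul_zero, mul_one, add_zero] at a00 a01 b00 b01
  have hαγ : (g : Matrix (Fin 2) (Fin 2) k) 0 0 * (g : Matrix (Fin 2) (Fin 2) k) 1 0 = 0 := by
    rcases mul_eq_zero.1 a00 with h | h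
    · rw [← a01, h, zero_mul, zero_mul]
    · rw [h, mul_zero]
  have hβδ : (g : Matrix (Fin 2) (Fin 2) k) 0 1 * (g : Matrix (Fin 2) (Fin 2) k) 1 1 = 0 := by
    rcases mul_eq_zero.1 b01 with h | h
    · rw [← b00, h, zero_mul, zero_mul]
    · rw [h, mul_zero]
  have hdet := GL2.det_ne_zero g
  rw [Matrix.det_fin_two] at hdet
  by_cases h00 : (g : Matrix (Fin 2) (Fin 2) k) 0 0 = 0
  · right
    have h01 : (g : Matrix (Fin 2) (Fin 2) k) 0 1 ≠ 0 := by
      intro h01; apply hdet; rw [h00, h01]; ring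
    exact ⟨h00, (mul_eq_zero.1 hβδ).resolve_left h01⟩
  · left
    have h10 : (g : Matrix (Fin 2) (Fin 2) k) 1 0 = 0 := (mul_eq_zero.1 hαγ).resolve_left h00
    have h11 : (g : Matrix (Fin 2) (Fin 2) k) 1 1 ≠ 0 := by
      intro h11; apply hdet; rw [h10, h11]; ring
    exact ⟨(mul_eq_zero.1 hβδ).resolve_right h11, h10⟩

/-- `Ad(D) E₀₁ = (a/b) E₀₁` for `D = diag(a, b)`. [folklore] -/
theorem adGL_E01_of_isDg (hE : (E : Matrix (Fin 2) (Fin 2) k) = !![0, 1; 0, 0]) (D : GL (Fin 2) k)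
    (hD : GL2.IsDg (D : Matrix (Fin 2) (Fin 2) k)) :
    (adZero (Fin 2) k).toRepresentation D E =
      ((D : Matrix (Fin 2) (Fin 2) k) 0 0 * ((D : Matrix (Fin 2) (Fin 2) k) 1 1)⁻¹) • E := by
  refine Subtype.ext ?_
  rw [coe_adGL_apply, Submodule.coe_smul, hE, conj_of_isDg D hD]
  ext i j
  fin_cases i <;> fin_cases j <;> simp

/-- `Ad(D) E₁₀ = (b/a) E₁₀` for `D = diag(a, b)`. [folklore] -/
theorem adGL_E10_of_isDg (hF : (F : Matrix (Fin 2) (Fin 2) k) = !![0, 0; 1, 0]) (D : GL (Fin 2) k)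
    (hD : GL2.IsDg (D : Matrix (Fin 2) (Fin 2) k)) :
    (adZero (Fin 2) k).toRepresentation D F =
      ((D : Matrix (Fin 2) (Fin 2) k) 1 1 * ((D : Matrix (Fin 2) (Fin 2) k) 0 0)⁻¹) • F := by
  refine Subtype.ext ?_
  rw [coe_adGL_apply, Submodule.coe_smul, hF, conj_of_isDg D hD]
  ext i j
  fin_cases i <;> fin_cases j <;> simp

/-- `det (Ad(g) w) = det w`. [folklore] -/
theorem det_coe_adGL (g : GL (Fin 2) k) (w : (adZero (Fin 2) k).toSubmodule) :
    (((adZero (Fin 2) k).toRepresentation g w : (adZero (Fin 2) k).toSubmodule) :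
      Matrix (Fin 2) (Fin 2) k).det = (w : Matrix (Fin 2) (Fin 2) k).det := by
  rw [coe_adGL_apply, Matrix.det_units_conj]

/-- If `Ad(g) w = c w` with `det w ≠ 0` then `c = ±1` (compare determinants). [folklore] -/
theorem eq_one_or_eq_neg_one_of_adGL_eq_smul {g : GL (Fin 2) k}
    {w : (adZero (Fin 2) k).toSubmodule} {c : k} (h : (adZero (Fin 2) k).toRepresentation g w = c • w)
    (hdet : (w : Matrix (Fin 2) (Fin 2) k).det ≠ 0) : c = 1 ∨ c = -1 := by
  have e : (((adZero (Fin 2) k).toRepresentation g w : (adZero (Fin 2) k).toSubmodule) :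
      Matrix (Fin 2) (Fin 2) k).det =
      ((c • w : (adZero (Fin 2) k).toSubmodule) : Matrix (Fin 2) (Fin 2) k).det := by rw [h]
  rw [det_coe_adGL, Submodule.coe_smul, Matrix.det_smul, Fintype.card_fin] at e
  have hcc : c * c = 1 := by
    have e' : (c * c - 1) * (w : Matrix (Fin 2) (Fin 2) k).det = 0 := by linear_combination -e
    rcases mul_eq_zero.1 e' with h' | h'
    · exact sub_eq_zero.1 h'
    · exact absurd h' hdet
  exact mul_self_eq_one_iff.1 hcc

/-- **The line through `w = a E₀₁ + b E₁₀`, `a ≠ 0`.**  If a subspace `W ⊆ ad⁰` consists of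
matrices with zero diagonal, contains `w`, but does not contain both `E₀₁` and `E₁₀`, then `W` is
the line `k w`. [folklore] -/
theorem exists_eq_smul_of_line (hE : (E : Matrix (Fin 2) (Fin 2) k) = !![0, 1; 0, 0])
    (hF : (F : Matrix (Fin 2) (Fin 2) k) = !![0, 0; 1, 0])
    (W : Submodule k (adZero (Fin 2) k).toSubmodule)
    (hW0 : ∀ v ∈ W, (v : Matrix (Fin 2) (Fin 2) k) 0 0 = 0) (hB : ¬ (E ∈ W ∧ F ∈ W)) {a b : k}
    (hw : a • E + b • F ∈ W) (ha : a ≠ 0) :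
    ∀ v ∈ W, ∃ c : k, v = c • (a • E + b • F) := by
  intro v hv
  obtain ⟨x, y, hveq⟩ : ∃ x y : k, v = x • E + y • F :=
    ⟨_, _, eq_add_of_apply_zero_zero hE hF v (hW0 v hv)⟩
  refine ⟨x * a⁻¹, ?_⟩
  have e : v - (x * a⁻¹) • (a • E + b • F) = (y - x * a⁻¹ * b) • F := by
    rw [hveq, smul_add, smul_smul, smul_smul, inv_mul_cancel_right₀ ha x]
    module
  by_contra hne
  have hcoef : y - x * a⁻¹ * b ≠ 0 := by
    intro h0
    rw [h0, zero_smul, sub_eq_zero] at e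
    exact hne e
  have hFW : F ∈ W := by
    have hmem : v - (x * a⁻¹) • (a • E + b • F) ∈ W := W.sub_mem hv (W.smul_mem _ hw)
    rw [e] at hmem
    exact (Submodule.smul_mem_iff W hcoef).1 hmem
  have hEW : E ∈ W := by
    have hmem : (a • E + b • F) - b • F ∈ W := W.sub_mem hw (W.smul_mem _ hFW)
    rw [add_sub_cancel_right] at hmem
    exact (Submodule.smul_mem_iff W ha).1 hmem
  exact hB ⟨hEW, hFW⟩

variable {G : Type v} [Group G]

/-- If every `ρ(g)` is lower triangular, `e₁` is a common eigenvector (the upper triangular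
version is the tree's `hasCommonEigenvector_of_apply_one_zero_eq_zero`). [folklore] -/
theorem hasCommonEigenvector_of_forall_apply_zero_one {ρ : G →* GL (Fin 2) k}
    (h : ∀ g, ((ρ g : GL (Fin 2) k) : Matrix (Fin 2) (Fin 2) k) 0 1 = 0) :
    HasCommonEigenvector ρ := by
  refine ⟨Pi.single 1 1, by simp, fun g ↦ ⟨((ρ g : GL (Fin 2) k) : Matrix (Fin 2) (Fin 2) k) 1 1, ?_⟩⟩
  ext i
  fin_cases i
  · simp [Matrix.mulVec, dotProduct, Fin.sum_univ_two, h g]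
  · simp [Matrix.mulVec, dotProduct, Fin.sum_univ_two]

/-- **A non-central element of `GL₂(k)` of finite order prime to `char k` is regular semisimple**
(`k` algebraically closed): it is conjugate to `diag(d₀, d₁)`, `d₀ ≠ d₁`
(`Serre1972.exists_conj_eq_diagonal_of_natCast_ne_zero`). [folklore] -/
theorem isRegularSemisimple_of_not_mem_center [IsAlgClosed k] {g : GL (Fin 2) k} {m : ℕ}
    (hm : (m : k) ≠ 0) (hgm : g ^ m = 1) (hg : g ∉ Subgroup.center (GL (Fin 2) k)) :
    IsRegularSemisimple g := by
  obtain ⟨Q, d, hd, hQ⟩ := Serre1972.exists_conj_eq_diagonal_of_natCast_ne_zero g hm hgm hg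
  have hDg : GL2.IsDg ((Q⁻¹ * g * Q : GL (Fin 2) k) : Matrix (Fin 2) (Fin 2) k) := by
    rw [hQ]; exact GL2.isDg_diagonal d
  have h1 : IsRegularSemisimple (Q⁻¹ * g * Q) := by
    refine isRegularSemisimple_of_isDg _ hDg ?_
    rw [hQ]; simpa using hd
  have h2 := isRegularSemisimple_scalar_mul_conj 1 Q h1
  rwa [map_one, one_mul, show Q * (Q⁻¹ * g * Q) * Q⁻¹ = g by group] at h2

end Matrices

/-! ## §2. Regular semisimplicity in a prime-to-`p` subgroup -/
section Semisimple

variable {k : Type u} [Field k] [IsAlgClosed k] {p : ℕ} [CharP k p]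

/-- Elements of a finite subgroup of `GL₂(k)` of order prime to `p = char k` that are not central
are regular semisimple. [folklore] -/
theorem isRegularSemisimple_of_mem_of_not_mem_center {H : Subgroup (GL (Fin 2) k)} [Finite H]
    (hcard : ¬ p ∣ Nat.card H) {g : GL (Fin 2) k} (hg : g ∈ H)
    (hgc : g ∉ Subgroup.center (GL (Fin 2) k)) : IsRegularSemisimple g := by
  have hcast : ((Nat.card H : ℕ) : k) ≠ 0 := fun h ↦ hcard ((CharP.cast_eq_zero_iff k p _).1 h)
  have hpow : g ^ Nat.card H = 1 := by
    have h := pow_card_eq_one' (G := H) (x := ⟨g, hg⟩)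
    have h' := congrArg Subtype.val h
    simpa only [Subgroup.coe_pow, Subgroup.coe_one] using h'
  exact isRegularSemisimple_of_not_mem_center hcast hpow hgc

end Semisimple


/-! ## §3. Clause (2a) in normal form -/
section Invariants

variable {k : Type u} [Field k] {G : Type v} [Group G]


/-- **Clause (2a) of "enormous" in normal form**: if `r : G → GL₂(k)` (`2 ≠ 0` in `k`) has no
common eigenvector and some `r(h₀) = D = diag(a, b)`, `a ≠ b`, then `(ad⁰)^{r(G)} = 0` — an
invariant `M ∈ ad⁰` commutes with `D`, so `M = diag(m, -m)`, and if `m ≠ 0` every `r(g)` commutes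
with `M`, hence is diagonal: a common eigenvector. [cite: ACCGHLNSTT2023, Def. 6.2.28 (2)] -/
theorem invariants_eq_bot_of_normalForm (htwo : (2 : k) ≠ 0) (r : G →* GL (Fin 2) k)
    (hce : ¬ HasCommonEigenvector r) {h₀ : G} (hD : GL2.IsDg ((r h₀ : GL (Fin 2) k) : Matrix (Fin 2) (Fin 2) k))
    (hab : ((r h₀ : GL (Fin 2) k) : Matrix (Fin 2) (Fin 2) k) 0 0 ≠ ((r h₀ : GL (Fin 2) k) : Matrix (Fin 2) (Fin 2) k) 1 1) :
    (Subgroup.adZeroRep r.range).invariants = ⊥ := by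
  set D : GL (Fin 2) k := r h₀ with hDdef
  have hDH : D ∈ r.range := ⟨h₀, rfl⟩
  rw [eq_bot_iff]
  intro M hM
  rw [Representation.mem_invariants] at hM
  rw [Submodule.mem_bot]
  have h1 : (D : Matrix (Fin 2) (Fin 2) k) * (M : Matrix (Fin 2) (Fin 2) k) * ((D⁻¹ : GL (Fin 2) k) : Matrix (Fin 2) (Fin 2) k) = M :=
    congrArg Subtype.val (hM ⟨D, hDH⟩)
  have htr : (M : Matrix (Fin 2) (Fin 2) k) 0 0 + (M : Matrix (Fin 2) (Fin 2) k) 1 1 = 0 := by rw [← Matrix.trace_fin_two]; exact M.2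
  -- `M` commutes with `D = diag(a, b)`, `a ≠ b`, hence is diagonal
  have hcomm : (M : Matrix (Fin 2) (Fin 2) k) * diagonal ![(D : Matrix (Fin 2) (Fin 2) k) 0 0, (D : Matrix (Fin 2) (Fin 2) k) 1 1] =
      diagonal ![(D : Matrix (Fin 2) (Fin 2) k) 0 0, (D : Matrix (Fin 2) (Fin 2) k) 1 1] * M := by
    rw [← hD.eq_diagonal]
    calc (M : Matrix (Fin 2) (Fin 2) k) * D = (D : Matrix (Fin 2) (Fin 2) k) * M * ((D⁻¹ : GL (Fin 2) k) : Matrix (Fin 2) (Fin 2) k) * D := by rw [h1]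
      _ = (D : Matrix (Fin 2) (Fin 2) k) * M := by rw [Matrix.mul_assoc, Units.inv_mul, Matrix.mul_one]
  have hMdg : GL2.IsDg (M : Matrix (Fin 2) (Fin 2) k) := GL2.isDg_of_commute_diagonal (x := (M : Matrix (Fin 2) (Fin 2) k)) hab hcomm
  by_contra hM0
  have hM00 : (M : Matrix (Fin 2) (Fin 2) k) 0 0 ≠ 0 := by
    intro h00
    have h11 : (M : Matrix (Fin 2) (Fin 2) k) 1 1 = 0 := by rwa [h00, zero_add] at htr
    apply hM0
    refine Subtype.ext ?_
    rw [Matrix.eta_fin_two (M : Matrix (Fin 2) (Fin 2) k), hMdg.1, hMdg.2, h00, h11]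
    ext i j; fin_cases i <;> fin_cases j <;> rfl
  have hMne : (M : Matrix (Fin 2) (Fin 2) k) 0 0 ≠ (M : Matrix (Fin 2) (Fin 2) k) 1 1 := by
    intro h
    rw [← h, ← two_mul] at htr
    exact hM00 ((mul_eq_zero.1 htr).resolve_left htwo)
  -- every `r g` commutes with `M = diag(m, -m)`, `m ≠ 0`, hence is diagonal
  refine hce (hasCommonEigenvector_of_forall_isDg fun g ↦ ?_)
  have h2 : ((r g : GL (Fin 2) k) : Matrix (Fin 2) (Fin 2) k) * (M : Matrix (Fin 2) (Fin 2) k) * (((r g)⁻¹ : GL (Fin 2) k) : Matrix (Fin 2) (Fin 2) k) = M :=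
    congrArg Subtype.val (hM ⟨r g, g, rfl⟩)
  have hcomm' : ((r g : GL (Fin 2) k) : Matrix (Fin 2) (Fin 2) k) * diagonal ![(M : Matrix (Fin 2) (Fin 2) k) 0 0, (M : Matrix (Fin 2) (Fin 2) k) 1 1] =
      diagonal ![(M : Matrix (Fin 2) (Fin 2) k) 0 0, (M : Matrix (Fin 2) (Fin 2) k) 1 1] * ((r g : GL (Fin 2) k) : Matrix (Fin 2) (Fin 2) k) := by
    rw [← hMdg.eq_diagonal]
    calc ((r g : GL (Fin 2) k) : Matrix (Fin 2) (Fin 2) k) * M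
        = ((r g : GL (Fin 2) k) : Matrix (Fin 2) (Fin 2) k) * M * (((r g)⁻¹ : GL (Fin 2) k) : Matrix (Fin 2) (Fin 2) k) * (r g : GL (Fin 2) k) := by
          rw [Matrix.mul_assoc, Units.inv_mul, Matrix.mul_one]
      _ = (M : Matrix (Fin 2) (Fin 2) k) * (r g : GL (Fin 2) k) := by rw [h2]
  exact GL2.isDg_of_commute_diagonal hMne hcomm'

end Invariants

end Summit.Langlands.Langlands.Cruxes.LocallyReducibleParallel.Potaut

end
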